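import Summits.QuantumFields.BalabanUV.T4Continuum.Spine.NE1p.DressedSuppliedAbsorptionWitness

/-!
# T⁴ programme, spine estimate NE1′ (node O3b/H2) — GENUINE ABSORPTION ON THE COMPOSITION FACE OF RECORD, PART 2: row S3u §2's three
# supplied ENDs FIRE on `towerR` with a WEIGHTED absorbed mass (`A·vR·mB = ⅛ > 0`), and the GENUINENESS records — births strictly
# INSIDE the class, the dressing alone does NOT pay, W32 §5 read on the new datum (crew row W37 = DAG N29zt, R-T114 (iii-a))

Cell `pub-balaban`, sub-cell `t4`, BINDER-OWNERS row NE1′, crew `b2b-balaban-t4-ne1p-formalise-*`, seat `leaf-02` (gen 13).  ADDITIVE —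
imports PART 1 `Spine/NE1p/DressedSuppliedAbsorptionWitness` ONLY (→ W32 → S3u, W20, W18); THEOREMS ONLY (0 def, 0 `def … : Prop`,
0 cite); nothing of S3u ∕ S5e ∕ S5b ∕ W18 ∕ W20 ∕ W32 ∕ Part 1 is restated.
* §4 THE END `suppliedAbsorption_fires : (liveness ∧ weighted-absorption records) ∧ DressedStabilityStrict towerR ((2:ℝ)^4)` = row S3u
  §2's `dressedStabilityStrict_of_suppliedComposition` BY NAME, ONE application, at `L = 2, c_δ = r = w = 1, c̄ = 0, N₀ = A₀ = 1, m = ½,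
  s̄⁰ = 0, ρ′ = ½, θ = ¼, Lb = 2, mB = v = vR = 1, A = ⅛, β₀ = ½` (`hbirth` READ THROUGH `RsR`: S5e's absorbed COUNT
  `count_absorbs_of_anchoring` and S5b's `absorbSmall_of_le` act with `A·N = ⅛`, fan-out `¼`); the headline (an `example` —
  its closed statement prints like W10's on ITS `towerR`) and ROOT-B `dressedBudget_towerR` (N0e `…_of_strict_comp` BY NAME).
* §5 GENUINENESS BY THEOREM: `absorbed_mass_pos` (`⅛·Σ_{absorbs b} pre > 0` for every birth `1 ≤ b ≤ K`), `dressing_lt_birth` (the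
  dressing alone does NOT pay for the birth — the A-term of `hlaw` is LOAD-BEARING; planted mutant `A := 0` in §4 ⇒ rc 1),
  `twelve_cR_le` ∕ `birth_lt_class` (`4·gen b b ≤ (16∕31)·(⅛)^(K−b) <` the class at birth — induction on the recursion, fixed point
  `½∕(1 − 1∕32)`), `oldest_at_half_class`, and `cure_is_beta0`: W32 §5's `A0_le_one_of_window` STILL binds at these gate scalars
  (`A₀ ≤ 1`, BY NAME) — the room is `β₀ = ½ < 1` ALONE; `absorption_weightless`'s premise `1 ≤ β₀` fails; W13's `A = ⅛`, which FAILS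
  S5b's amplitude test on `towerC` (`4∕3`, W32's closing `example`), PASSES here (`⅔`).

HONEST FRAMING (c4; offered wording, typer R-T113 (iv)) — as Part 1: «Row S3u §2's supplied ENDs fire on a decided (γ)-datum with a
WEIGHTED absorbed mass …, births strictly inside the class and window room — the cure W32 §5 located; SOCKET COMPOSITION certified,
NOT that an ℝ-operation ∕ minimisers ∕ components of [Balaban1989LargeFieldII] were constructed or bounded; S3v's supplied ENDs
untouched; discharges no wall item; the wall line v1.6 does NOT move; R-t4r2-Q2 NOT met thereby; NE1′ NOT proved.»  [decided toy] ∕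
[folklore]; 0 citations.  NE1′ NOT printed, NOT proved; spine PROVED 0∕9; count 9 unchanged.  Rung (B)+1 on ONE finite four-torus —
NOT infinite volume, NOT a mass gap, NOT OS on ℝ⁴, NOT Clay.  HONEST DEPENDENCY: continuum YM on T⁴ ⇐ BetaPertH ∧ nine spine estimates
(0/9 proved); BetaPertH ⇐ (D1) ∧ (D4) ∧ CAP+tail; G-an2-4 gates asym, D1 and NE2/3/4.
-/

noncomputable section

namespace Summit.QuantumFields.BalabanUV.T4Continuum.NE1p.DressedSuppliedAbsorptionWitnessEnd

open Set Metric Finset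
open scoped BigOperators
open Literature.MathematicalPhysics.QuantumFieldTheory.Balaban1983to89
open Literature.MathematicalPhysics.QuantumFieldTheory.Balaban1983to89.T4TermFormat
open Literature.MathematicalPhysics.QuantumFieldTheory.Balaban1983to89.T4FeltGeometry
open Literature.MathematicalPhysics.QuantumFieldTheory.Balaban1983to89.T4TrajectoryComparison
open Literature.MathematicalPhysics.QuantumFieldTheory.Balaban1983to89.T4BirthChartTransport (GaugeInvariant BirthSlice RelGauge)
open Literature.MathematicalPhysics.QuantumFieldTheory.Balaban1983to89.T4PreservedUnderR (RStep)
open Summit.QuantumFields.BalabanUV.T4Continuum.T4TrajectoryDensityDressed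
open Summit.QuantumFields.BalabanUV.T4Continuum.NE1p.DressedRoot
open Summit.QuantumFields.BalabanUV.T4Continuum.NE1p.DressedUniformConstants
open Summit.QuantumFields.BalabanUV.T4Continuum.NE1p.DressedAbsorptionWindow
open Summit.QuantumFields.BalabanUV.T4Continuum.NE1p.DressedRootComposition
open Summit.QuantumFields.BalabanUV.T4Continuum.NE1p.DressedStabilityStrictOfSuppliedComposition
open Summit.QuantumFields.BalabanUV.T4Continuum.NE1p.DressedValueMapWitness (vmap norm_vmap vmap_affine theta_pow_le_one)
open Summit.QuantumFields.BalabanUV.T4Continuum.NE1p.DressedSuppliedCompositionWitness (A0_le_one_of_window absorption_weightless)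

open Summit.QuantumFields.BalabanUV.T4Continuum.NE1p.DressedSuppliedAbsorptionWitness

/-! ## §4 THE END: row S3u §2's three supplied ENDs fire with a weighted absorbed mass -/

/-- [folklore] The multiplicity is ATTAINED at the origin block for every birth scale `j ≤ K`. -/
theorem hmult_attained (K : ℕ) {j : ℕ} (hj : j ≤ K) :
    ((BR K).births.filter fun b => (BR K).birthScale b = j ∧ (0 : Fin 4 → ℕ) ∈ (anchR K).dom b).card = 1 := by
  refine card_eq_one.mpr ⟨⟨j, Nat.lt_succ_of_le hj⟩, eq_singleton_iff_unique_mem.mpr ⟨?_, fun f hf => Fin.ext (mem_filter.mp hf).2.1⟩⟩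
  exact mem_filter.mpr ⟨(BR K).mem_births _, rfl, mem_singleton_self _⟩

/-- **THE WINDOW HAS ROOM** [arith]: at `A = ⅛`, `vR·mB = 1`, `ρ′ = ½`, `β₀ = ½`: fan-out `¼ < 1` and amplitude `⅔ ≤ 1 = A₀` — NOT
tight (W18∕W32: `A = 0`, amplitude `1`). [folklore] -/
theorem window_room :
    fanout (1 / 8) (((1 : ℕ) : ℝ) * ((1 : ℕ) : ℝ)) (1 / 2) < 1 ∧
      absorbAmplitude (1 / 2) (1 / 8) (((1 : ℕ) : ℝ) * ((1 : ℕ) : ℝ)) (1 / 2) ≤ 1 := by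
  unfold absorbAmplitude fanout
  norm_num


/-- **GENUINE ABSORPTION ON THE COMPOSITION FACE OF RECORD** [decided toy]: (i) the supplier data are LIVE (multiplicity and volume
ATTAINED, housing) AND the absorption is WEIGHTED (`absorbs` non-empty with a positive absorbed mass at every birth `1 ≤ b ≤ K`, the
dressing STRICTLY below the birth size), AND (ii) `DressedStabilityStrict towerR ((2:ℝ)^4)` = row S3u §2's
`dressedStabilityStrict_of_suppliedComposition` BY NAME, ONE application, at `L = 2, c_δ = r = w = 1, c̄ = 0, N₀ = A₀ = 1, m = ½,
s̄⁰ = 0, ρ′ = ½, θ = ¼, Lb = 2, mB = v = vR = 1, A = ⅛, β₀ = ½` — `hbirth` READ THROUGH `RsR` (S5e inside S3u: the absorbed COUNT by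
`count_absorbs_of_anchoring`, the smallness by S5b's `absorbSmall_of_le` at fan-out `¼`). [folklore] -/
theorem suppliedAbsorption_fires :
    ((∀ K j, j ≤ K → ((BR K).births.filter fun b => (BR K).birthScale b = j ∧ (0 : Fin 4 → ℕ) ∈ (anchR K).dom b).card = 1) ∧
      (∀ K k (b : (BR K).Birth), ∀ f ∈ SR K k b, ∃ q ∈ compR K k b, f ∈ (BR K).feltAt q) ∧
      (∀ K j (hj : j + 1 ≤ K), 0 < 1 / 8 * ∑ b₀ ∈ (RsR K).absorbs ⟨j + 1, Nat.lt_succ_of_le hj⟩, (RsR K).pre b₀ (j + 1)) ∧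
      (∀ K j, j + 1 ≤ K → βR K (j + 1) < 4 * 1 / 1 * (3 * cR K (j + 1)))) ∧
    DressedStabilityStrict towerR ((2 : ℝ) ^ 4) := by
  refine ⟨⟨fun K j hj => hmult_attained K hj, fun K => hhoused_R K, fun K j hj => ?_, fun K j _ => ?_⟩, ?_⟩
  · rw [absorbed_sum_eq K j hj]; exact mul_pos (by norm_num) (mul_pos (by norm_num) (cR_pos K j))
  · unfold βR; nlinarith [cR_succ K j, cR_pos K j]
  exact dressedStabilityStrict_of_suppliedComposition towerR (fun _ K => anchR K) (fun _ K => RsR K)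
    (L := 2) (cδ := 1) (cbar := 0) (N₀ := 1) (A₀ := 1) (m := 1 / 2) (sbar := 0) (ρ' := 1 / 2) (θ := 1 / 4) (A := 1 / 8) (β₀ := 1 / 2)
    (mB := 1) (v := 1) (vR := 1)
    (move := fun U d t : ℂ => U + t * d) (N := fun d : ℂ => ‖d‖) (w := 1) (r := 1)
    (moveX := fun U d t : ℂ => U + t * d) (NX := fun d : ℂ => ‖d‖)
    (G := fun _ K b k' => FnR K b k') (rel := fun _ _ _ _ U U' => U = U') (𝒦 := fun _ _ _ _ => closedBall (0 : ℂ) 1)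
    (V := fun _ _ _ k' k => vmap k' k) (𝒦X := fun _ _ _ => closedBall (0 : ℂ) 1) (relX := fun _ _ _ U U' => U = U')
    (δX := fun _ _ _ => (1 : ℝ)) (c := fun _ _ _ => 0) (s₀ := fun _ _ _ _ => 0) (S := fun _ K => SR K)
    (comp := fun _ K => compR K) (β := fun _ K => βR K)
    (by norm_num) zero_le_one one_pos le_rfl zero_le_one zero_le_one (by norm_num)
    (by unfold locOf; norm_num) (by norm_num) (by norm_num)
    (by norm_num) (by norm_num)
    (fun _ _ _ => zero_le_one) (fun _ _ _ => le_rfl) (fun _ _ _ => le_rfl)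
    (fun _ K => hG_R K _) (fun _ K b k' => hinv_R K b k') (fun U d => by simp)
    (fun _ K => hneX_R K _) (fun _ K => hsupX_R K _)
    (fun _ _ _ => le_rfl) (fun _ _ _ _ => le_rfl) (fun _ _ _ _ => le_rfl) (fun _ K => hreg_R K _)
    (by norm_num) (fun _ K => hmult_R K) (fun _ K => hscale_R K) (fun _ K => hhoused_R K) (fun _ K => hvol_R K) (by norm_num)
    (fun _ K => compVol_RsR K) (fun _ K => preBelowEnv_RsR K _) (by norm_num) (fun _ K => absorbLaw_RsR K) (fun _ K => hβ_R K)
    window_room.1 window_room.2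
    (fun _ K => hVK_R K) (fun _ K => hVrel_R K)

/-- [folklore] **THE HEADLINE END FIRES** (N0e `dressedStability_of_strict_comp` BY NAME) — an `example`: the closed statement prints like
W10's `DressedTowerWitnessRegen.dressedStability_towerR` on ITS (different) `towerR` (`dedup.landed` textual twin; W32 precedent). -/
example : DressedStability towerR := dressedStability_of_strict_comp suppliedAbsorption_fires.2

/-- [folklore] At most one family per birth scale: any scale-`j` fibre is counted by `1 ≤ 1·(2⁴)^n` (for ROOT-B's positional count). -/
theorem positionalCount_R (K : ℕ) : (BR K).PositionalCount fun j k => 1 * ((2 : ℝ) ^ 4) ^ (k - j) := by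
  intro q j
  have h1 : (((BR K).feltAt q).filter fun f => (BR K).birthScale f = j).card ≤ 1 :=
    card_le_one.mpr fun f hf f' hf' => Fin.ext (((mem_filter.mp hf).2).trans ((mem_filter.mp hf').2).symm)
  have h : ((((BR K).feltAt q).filter fun f => (BR K).birthScale f = j).card : ℝ) ≤ 1 := by exact_mod_cast h1
  exact h.trans (by simpa using one_le_pow₀ (M₀ := ℝ) (a := (2 : ℝ) ^ 4) (n := (BR K).cubeScale q - j) (by norm_num))

/-- **ROOT-B FIRES** [decided toy]: for nonnegative cube weights bounded by `w̄`, `DressedBudget towerR wt` (N0e `dressedBudget_of_strict_comp`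
BY NAME with the positional count `1·16^(k−j)`). [folklore] -/
theorem dressedBudget_towerR {wt : Unit → ℕ → ℕ → ℝ} {wbar : ℝ} (hwbar : 0 ≤ wbar) (hw0 : ∀ p K, ∀ j ≤ K, 0 ≤ wt p K j)
    (hwb : ∀ p K, ∀ j ≤ K, wt p K j ≤ wbar) : DressedBudget towerR wt :=
  dressedBudget_of_strict_comp (L := 2) (N₀ := 1) suppliedAbsorption_fires.2 zero_le_one hwbar hw0 hwb fun _ K => positionalCount_R K

/-! ## §5 GENUINENESS BY THEOREM, and W32 §5 read on the new datum -/

/-- **THE ABSORBED MASS IS POSITIVE** [decided toy]: for every birth `1 ≤ b ≤ K` the A-term of the law is `⅛·(3·cR K (b−1)) > 0` —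
`A·N = ⅛·1 > 0` AND the absorbed sum is non-zero (contrast: W32 §5 `absorption_weightless` forces `A·N = 0` on `towerC`). [folklore] -/
theorem absorbed_mass_pos (K j : ℕ) (hj : j + 1 ≤ K) :
    0 < 1 / 8 * ∑ b₀ ∈ (RsR K).absorbs ⟨j + 1, Nat.lt_succ_of_le hj⟩, (RsR K).pre b₀ (j + 1) :=
  (suppliedAbsorption_fires.1.2.2.1) K j hj

/-- **THE DRESSING ALONE DOES NOT PAY FOR THE BIRTH** [decided toy]: `βR K b < 4·gen b b` for every `b ≥ 1` — the absorption term of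
`hlaw` is LOAD-BEARING (the planted mutant `A := 0` breaks `absorbLaw_RsR`). [folklore] -/
theorem dressing_lt_birth (K j : ℕ) (hj : j + 1 ≤ K) :
    βR K (j + 1) < 4 * 1 / 1 * (TR K).gen ⟨j + 1, Nat.lt_succ_of_le hj⟩ (j + 1) := by
  show βR K (j + 1) < 4 * 1 / 1 * (if j + 1 = j + 1 then 3 * cR K (j + 1) else 0)
  rw [if_pos rfl]
  exact (suppliedAbsorption_fires.1.2.2.2) K j hj

/-- **BIRTHS AT MOST 16∕31 OF THE CLASS** [arith on the toy]: `12·cR K j ≤ (16∕31)·(⅛)^(K−j)` — induction on the recursion (the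
absorbed family is one class-step older: factor `⅜∕12 = 1∕32`, fixed point `½∕(1 − 1∕32) = 16∕31`). [folklore] -/
theorem twelve_cR_le (K : ℕ) : ∀ j, 12 * cR K j ≤ (16 / 31 : ℝ) * (1 / 8 : ℝ) ^ (K - j)
  | 0 => by
    rw [cR_zero, Nat.sub_zero]
    have h8 : (0 : ℝ) ≤ (1 / 8 : ℝ) ^ K := by positivity
    nlinarith
  | j + 1 => by
    have ih := twelve_cR_le K j
    have hmono : (1 / 8 : ℝ) ^ (K - j) ≤ (1 / 8 : ℝ) ^ (K - (j + 1)) :=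
      pow_le_pow_of_le_one (by norm_num) (by norm_num) (Nat.sub_le_sub_left (Nat.le_succ j) K)
    have hpos : (0 : ℝ) ≤ (1 / 8 : ℝ) ^ (K - (j + 1)) := by positivity
    rw [cR_succ]
    nlinarith

/-- **BIRTHS STRICTLY INSIDE THE CLASS** [decided toy]: at every birth scale `j ≤ K`, `4·gen b b ≤ (16∕31)·(⅛)^(K−j) < twoRate 1 ρ₁ ⅛ K j j`
(the class at birth is `1·(⅛)^(K−j)`; `towerC`'s births sit ON it — the premise of W32 §5 `beta0_ge_one_of_absorbLaw` is gone). [folklore] -/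
theorem birth_lt_class (K : ℕ) (b : (BR K).Birth) :
    4 * 1 / 1 * (TR K).gen b ((BR K).birthScale b) <
      twoRate 1 (rhoOneOf ((2 : ℝ) ^ 2)⁻¹ 1 (4 * 1 / 1) 0) ((2 : ℝ)⁻¹ ^ 3) (BR K).K ((BR K).birthScale b) ((BR K).birthScale b) := by
  show 4 * 1 / 1 * (if b.val = b.val then 3 * cR K b.val else 0) <
    twoRate 1 (rhoOneOf ((2 : ℝ) ^ 2)⁻¹ 1 (4 * 1 / 1) 0) ((2 : ℝ)⁻¹ ^ 3) K b.val b.val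
  rw [if_pos rfl]
  unfold twoRate
  have h := twelve_cR_le K b.val
  have hpos : (0 : ℝ) < (1 / 8 : ℝ) ^ (K - b.val) := by positivity
  norm_num at h ⊢
  nlinarith

/-- **THE OLDEST FAMILY IS BORN AT HALF THE CLASS** [decided toy]: `4·gen ⟨0⟩ 0 = ½·(⅛)^K` — on `towerC` it was `(⅛)^K` exactly, which is
what forced `1 ≤ β₀` there (W32 §5 `beta0_ge_one_of_absorbLaw`). [folklore] -/
theorem oldest_at_half_class (K : ℕ) : 4 * 1 / 1 * (TR K).gen ⟨0, Nat.succ_pos K⟩ 0 = (1 / 2 : ℝ) * (1 / 8 : ℝ) ^ K := by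
  show 4 * 1 / 1 * (if (0 : ℕ) = 0 then 3 * cR K 0 else 0) = _
  rw [if_pos rfl]
  linarith [cR_zero K]

/-- **W32 §5 READ ON THE NEW DATUM** [arith]: the pinned gate scalars are W18's, so `A0_le_one_of_window` STILL forces `A₀ ≤ 1` (first
conjunct, BY NAME at this file's numbers) — the room is `β₀ = ½ < 1` ALONE: `absorption_weightless`'s premise `1 ≤ β₀` FAILS (second),
and W13's `A = ⅛`, which fails S5b's amplitude test at `β₀ = 1` (`4∕3`, W32's closing `example`), PASSES at `β₀ = ½` (`⅔`, third). [folklore] -/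
theorem cure_is_beta0 :
    (∀ A₀ : ℝ, 0 ≤ A₀ → 1 / 2 * (1 * A₀ * (1 - 1 / 2)⁻¹) ≤ 1 - 0 → A₀ ≤ 1) ∧ ¬ ((1 : ℝ) ≤ 1 / 2) ∧
      (¬ absorbAmplitude 1 (1 / 8) 1 (1 / 2) ≤ 1 ∧ absorbAmplitude (1 / 2) (1 / 8) 1 (1 / 2) ≤ 1) := by
  refine ⟨fun A₀ hA₀ h => A0_le_one_of_window (N₀ := 1) (ρ' := 1 / 2) (sbar := 0) (cbar := 0) le_rfl hA₀ le_rfl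
    (by unfold locOf; norm_num) (by norm_num) le_rfl h, by norm_num, ?_, ?_⟩
  · unfold absorbAmplitude fanout; norm_num
  · unfold absorbAmplitude fanout; norm_num

/-- [folklore] §5 IN ONE LINE: on `towerR` the hypotheses of W32's `absorption_weightless` are met EXCEPT `1 ≤ β₀`, and its conclusion
`A·N = 0` is FALSE (`⅛·1 ≠ 0`) — the absorption is weighted. -/
example : fanout (1 / 8) 1 (1 / 2) < 1 ∧ absorbAmplitude (1 / 2) (1 / 8) 1 (1 / 2) ≤ 1 ∧ (1 / 8 : ℝ) * 1 ≠ 0 := by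
  unfold absorbAmplitude fanout; norm_num

end Summit.QuantumFields.BalabanUV.T4Continuum.NE1p.DressedSuppliedAbsorptionWitnessEnd

end
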